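import Summits.Ventures.PercRepro.Night2FatXLine
import Summits.Ventures.PercRepro.Night2TwoOneTypes

/-!
# night-2: the fat count from an UNLOADED FAMILY of `Y`'s

The counting theorems of gens 32–34 (`fat_count_level_ge'`, `fat_count_level_ge_cross`, `fat_count_level_ge_free_point`)
all run the same argument: a family of subsets `Y ⊆ W ∖ {x}` whose targets `Q ∪ {x} ∪ Y` are unloaded injects into
the unloaded level-`j` targets through `x`, each worth `fatTerm j c_j`.  **`fat_count_level_ge_family`** states it
once for an arbitrary decidable predicate `P` on `Y` (the geometry enters only through the hypothesis
`hP : P Y → dload (Q ∪ {x} ∪ Y) = 0`), so that the degenerate regime's families (a side point and a free point, two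
side points, the points on no non-class basis line) share one count.  Paper `proofs/NIGHT-2-g35.md` §2.
-/

namespace PercRepro.Shadow

open PercRepro.ThmH PercRepro.PerFlat

variable {α : Type*} [DecidableEq α] {M : Matroid α} [M.Finite] {G : Finset α}

/-- **The level-`j` sum over the unloaded targets above `Q ∪ {x}` dominates the number of `(j − 1)`-subsets `Y` of
`W ∖ {x}` satisfying `P`**, each worth `fatTerm j c_j`, whenever every target `Q ∪ {x} ∪ Y` with `P Y` is unloaded. -/
theorem fat_count_level_ge_family (hG : G ∈ flatsQ M (5 + 1)) (hd : (gr M \ G).card = 2)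
    (hk : kColoops M G = 1) {B : Finset α} (hB : B ∈ thinMembers M 5 G) (hnP : ¬ bigP M G B) {z : α}
    (hz : z ∈ G \ clF M B) {x : α} (hx : x ∈ G \ insert z B) (P : Finset α → Prop) [DecidablePred P]
    {j : ℕ} (hj : 1 ≤ j)
    (hP : ∀ T ∈ tgtSets M 5 G B z, x ∈ T → (T \ insert z B).card = j → P ((T \ insert z B).erase x) →
      dload M 5 G (bigP M G) (dshGT2 M 5 G) T = 0) :
    ((((((G \ insert z B).erase x).powersetCard (j - 1)).filter P).card : ℕ) : ℚ) *
      fatTerm j (if (G \ insert z B).card - j ≤ 3 then 1 else 11 / 18) ≤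
      ∑ T ∈ ((tgtSets M 5 G B z).filter
        (fun T => x ∈ T ∧ dload M 5 G (bigP M G) (dshGT2 M 5 G) T = 0)).filter
        (fun T => (T \ insert z B).card = j),
        capS M 5 G T / ((221 / 360 : ℚ) * ((2 * ((T \ coloops M G).card - 2).choose 4 : ℕ) : ℚ)) := by
  have hBm : B ∈ membersIn M (Uq M (5 + 2) 5) G := (mem_thinMembers.1 hB).1
  have hxQ : x ∉ insert z B := (Finset.mem_sdiff.1 hx).2
  set W' := (G \ insert z B).erase x with hW'
  set S := (W'.powersetCard (j - 1)).filter P with hS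
  set F := ((tgtSets M 5 G B z).filter
    (fun T => x ∈ T ∧ dload M 5 G (bigP M G) (dshGT2 M 5 G) T = 0)).filter
    (fun T => (T \ insert z B).card = j) with hF
  have key : ∀ Y, Y ⊆ W' → ((insert z B ∪ ({x} ∪ Y)) \ insert z B).erase x = Y := by
    intro Y hYW
    have hXY : {x} ∪ Y ⊆ G \ insert z B :=
      Finset.union_subset (Finset.singleton_subset_iff.2 hx) (hYW.trans (Finset.erase_subset _ _))
    have hxY : x ∉ Y := fun h' => (Finset.mem_erase.1 (hYW h')).1 rfl
    rw [Finset.union_sdiff_left, Finset.sdiff_eq_self_of_disjoint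
      (Finset.disjoint_of_subset_left hXY Finset.sdiff_disjoint)]
    ext e
    simp only [Finset.mem_erase, Finset.mem_union, Finset.mem_singleton]
    constructor
    · rintro ⟨hex, h | h⟩
      · exact absurd h hex
      · exact h
    · intro he
      exact ⟨fun h' => hxY (h' ▸ he), Or.inr he⟩
  -- the map `Y ↦ Q ∪ ({x} ∪ Y)` sends `S` injectively into `F`
  have hmaps : ∀ Y ∈ S, insert z B ∪ ({x} ∪ Y) ∈ F := by
    intro Y hY
    rw [hS, Finset.mem_filter, Finset.mem_powersetCard] at hY
    obtain ⟨⟨hYW, hYc⟩, hPY⟩ := hY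
    have hXY : {x} ∪ Y ⊆ G \ insert z B :=
      Finset.union_subset (Finset.singleton_subset_iff.2 hx) (hYW.trans (Finset.erase_subset _ _))
    have hxY : x ∉ Y := fun h' => (Finset.mem_erase.1 (hYW h')).1 rfl
    have hcard : ({x} ∪ Y).card = j := by
      rw [Finset.card_union_of_disjoint (Finset.disjoint_singleton_left.2 hxY), Finset.card_singleton, hYc]
      omega
    have hTt : insert z B ∪ ({x} ∪ Y) ∈ tgtSets M 5 G B z := by
      rw [tgtSets_eq_image hG hBm hz, Finset.mem_image]
      exact ⟨{x} ∪ Y, Finset.mem_filter.2 ⟨Finset.mem_powerset.2 hXY,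
        ⟨x, Finset.mem_union_left _ (Finset.mem_singleton_self _)⟩⟩, rfl⟩
    have hsd : (insert z B ∪ ({x} ∪ Y)) \ insert z B = {x} ∪ Y := by
      rw [Finset.union_sdiff_left]
      exact Finset.sdiff_eq_self_of_disjoint (Finset.disjoint_of_subset_left hXY Finset.sdiff_disjoint)
    have hxT : x ∈ insert z B ∪ ({x} ∪ Y) :=
      Finset.mem_union_right _ (Finset.mem_union_left _ (Finset.mem_singleton_self _))
    have hlev : ((insert z B ∪ ({x} ∪ Y)) \ insert z B).card = j := by rw [hsd, hcard]
    have hload := hP _ hTt hxT hlev (by rw [key Y hYW]; exact hPY)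
    rw [hF, Finset.mem_filter, Finset.mem_filter]
    exact ⟨⟨hTt, hxT, hload⟩, hlev⟩
  have hinj : Set.InjOn (fun Y => insert z B ∪ ({x} ∪ Y)) (S : Set (Finset α)) := by
    intro Y₁ hY₁ Y₂ hY₂ heq
    rw [Finset.mem_coe, hS, Finset.mem_filter, Finset.mem_powersetCard] at hY₁ hY₂
    have h1 := key Y₁ hY₁.1.1
    have h2 := key Y₂ hY₂.1.1
    simp only at heq
    rw [← h1, ← h2, heq]
  have hcount : S.card ≤ F.card := Finset.card_le_card_of_injOn _ (fun Y hY => hmaps Y hY) hinj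
  have hterm : ∀ T ∈ F, fatTerm j (if (G \ insert z B).card - j ≤ 3 then 1 else 11 / 18) ≤
      capS M 5 G T / ((221 / 360 : ℚ) * ((2 * ((T \ coloops M G).card - 2).choose 4 : ℕ) : ℚ)) := by
    intro T hT
    rw [hF, Finset.mem_filter, Finset.mem_filter] at hT
    obtain ⟨⟨hTt, -, -⟩, hTj⟩ := hT
    have hTG : T ⊆ G := subset_G_of_mem_shadowAt (mem_tgtSets.1 hTt).1
    have hTK : (T \ coloops M G).card = j + 5 := by
      rw [card_sdiff_coloops_eq_level_add_five hG hd hk hB hnP hz hTt, hTj]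
    have hGT := card_sdiff_add_card_sdiff_of_mem_tgtSets hTt
    unfold fatTerm
    rw [hTK, show j + 5 - 2 = j + 3 by omega]
    apply div_le_div_of_nonneg_right _ (by positivity)
    split_ifs with h3
    · rw [capS_eq_one_of_card_sdiff_le_three hd (by omega)]
    · exact capS_ge_eleven_eighteenths_two_one hd hk hTG
  have hpos : 0 ≤ fatTerm j (if (G \ insert z B).card - j ≤ 3 then 1 else 11 / 18) := by
    unfold fatTerm
    split_ifs <;> positivity
  calc (S.card : ℚ) * fatTerm j (if (G \ insert z B).card - j ≤ 3 then 1 else 11 / 18)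
      ≤ (F.card : ℚ) * fatTerm j (if (G \ insert z B).card - j ≤ 3 then 1 else 11 / 18) := by
        apply mul_le_mul_of_nonneg_right _ hpos
        exact_mod_cast hcount
    _ = ∑ _T ∈ F, fatTerm j (if (G \ insert z B).card - j ≤ 3 then 1 else 11 / 18) := by
        rw [Finset.sum_const, nsmul_eq_mul]
    _ ≤ _ := Finset.sum_le_sum (fun T hT => hterm T hT)

end PercRepro.Shadow
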